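import Literature.NumberTheory.Sieve.HeathBrownSSum
import Mathlib.NumberTheory.Harmonic.Bounds

/-!
# Tools for Heath-Brown's principal estimate (HB86 §4, towards Lemma 5)

Source: D. R. Heath-Brown, *The divisor function `d₃(n)` in arithmetic progressions*, Acta Arith.
47 (1986), §4, pp. 41–44 [cite: HeathBrown1986d3]. Elementary bricks for the proof of Lemma 5
(the principal estimate for `N(U, V, W)`), independent of the `S`-sum bounds of §3:

* `mul_sum_K2_conj_eq_sum_SS` — the completion behind (4.6)–(4.7):
  `q ∑*_{h ∈ (H₁,H₂]} K(ht₁) conj K(ht₂) = ∑_{k mod q} S(āk, t₁, t₂, ρ, σ; q) ∑_{h} e_q(−kh)`, `K(n) = K₂(ρ,σ,an;q)`.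
* `gcd_sq_le_sq_gcd`, `sqrt_gcd_sq_le`, `sum_div_filter_dvd_le`, `sum_sqrt_gcd_sq_div_le` — HB p. 43:
  `∑_{k ≤ N} (k², D)^{1/2}/k ≤ d(D)(1 + log N)`.
* `K2_scale_units` (`K₂(ρr', σs', c) = K₂(ρ, σ, r's'c)` for units `r', s'`, HB p. 41),
  `K2_first_zero_unit_mul`, `K2_second_zero_unit_mul` (the `r ≡ 0` / `s ≡ 0` terms do not depend on the
  unit `a`: `N₁` is independent of `a`).
* `sum_gcd_le_card_divisors_mul` — `∑_{m ≤ M} (m, q) ≤ d(q) M` (counting for the `t₁ ≠ t₂` terms, p. 43).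
* `qpart` — the `q`-part `ρ(N) = ∏_{p ∣ q} p^{v_p(N)}` with `qpart_dvd`, `coprime_div_qpart`
  (`(N/ρ(N), q) = 1`), `primeFactors_qpart_subset`, `gcd_qpart_eq` (HB's `r = ρ r'`, p. 41).
* `sum_smooth_rpow_neg_le` — `∑_{n ≤ B, rad(n) ∣ ∏S} n^{−t} ≤ ∏_{p ∈ S} (1 − p^{−t})⁻¹`, which (with
  `2^{ω(q)} ≤ d(q)`) replaces the smooth-number count (4.2) (de Bruijn) in the summation over `ρ, σ`.
-/

open Finset

namespace Literature.NumberTheory.Sieve.HeathBrown1986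

variable {q : ℕ} [NeZero q]

set_option maxHeartbeats 1600000 in
/-- **(4.6) completed**: with `K(n) = K₂(ρ, σ, an; q)` (`a` a unit),
`q · ∑_{h ∈ (H₁, H₂], (h,q)=1} K(ht₁) conj K(ht₂) = ∑_{k mod q} S(āk, t₁, t₂, ρ, σ; q) ∑_{h ∈ (H₁,H₂]} e_q(−kh)`.
[cite: HeathBrown1986d3, §4 p.43] -/
theorem mul_sum_K2_conj_eq_sum_SS (a : ZMod q) (ha : IsUnit a) (ρ σ t₁ t₂ : ZMod q) (H₁ H₂ : ℕ) :
    (q : ℂ) * ∑ h ∈ Ioc H₁ H₂, (if IsUnit ((h : ℕ) : ZMod q) then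
        K2 q ρ σ (a * (h : ℕ) * t₁) * starRingEnd ℂ (K2 q ρ σ (a * (h : ℕ) * t₂)) else 0) =
      ∑ k : ZMod q, SS q (a⁻¹ * k) t₁ t₂ ρ σ *
        ∑ h ∈ Ioc H₁ H₂, (ZMod.stdAddChar (-(k * ((h : ℕ) : ZMod q))) : ℂ) := by
  classical
  have ia : a * a⁻¹ = 1 := ZMod.mul_inv_of_unit a ha
  -- expand `SS` and move the `k`-sum inside
  have hR : ∀ k : ZMod q, SS q (a⁻¹ * k) t₁ t₂ ρ σ *
      ∑ h ∈ Ioc H₁ H₂, (ZMod.stdAddChar (-(k * ((h : ℕ) : ZMod q))) : ℂ) =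
      ∑ j : ZMod q, ∑ h ∈ Ioc H₁ H₂, (if IsUnit j then
        K2 q ρ σ (j * t₁) * starRingEnd ℂ (K2 q ρ σ (j * t₂)) *
          (ZMod.stdAddChar (k * (a⁻¹ * j - ((h : ℕ) : ZMod q))) : ℂ) else 0) := by
    intro k
    unfold SS
    rw [Finset.sum_mul]
    refine Finset.sum_congr rfl fun j _ => ?_
    rw [Finset.mul_sum]
    refine Finset.sum_congr rfl fun h _ => ?_
    split_ifs with hj
    · rw [show k * (a⁻¹ * j - ((h : ℕ) : ZMod q)) = a⁻¹ * k * j + -(k * ((h : ℕ) : ZMod q)) by ring,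
        AddChar.map_add_eq_mul]
      ring
    · rw [zero_mul]
  simp_rw [hR]
  rw [Finset.sum_comm]
  -- now `∑_j ∑_k ∑_h`; swap `k` and `h` and sum over `k`
  have hj : ∀ j : ZMod q, ∑ k : ZMod q, ∑ h ∈ Ioc H₁ H₂, (if IsUnit j then
        K2 q ρ σ (j * t₁) * starRingEnd ℂ (K2 q ρ σ (j * t₂)) *
          (ZMod.stdAddChar (k * (a⁻¹ * j - ((h : ℕ) : ZMod q))) : ℂ) else 0) =
      ∑ h ∈ Ioc H₁ H₂, (if IsUnit j ∧ a⁻¹ * j = ((h : ℕ) : ZMod q) then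
        (q : ℂ) * (K2 q ρ σ (j * t₁) * starRingEnd ℂ (K2 q ρ σ (j * t₂))) else 0) := by
    intro j
    rw [Finset.sum_comm]
    refine Finset.sum_congr rfl fun h _ => ?_
    by_cases hju : IsUnit j
    · simp only [if_pos hju]
      rw [← Finset.mul_sum, sum_stdAddChar_mul_right]
      by_cases he : a⁻¹ * j = ((h : ℕ) : ZMod q)
      · rw [if_pos (sub_eq_zero.mpr he), if_pos ⟨hju, he⟩, mul_comm]
      · rw [if_neg (fun h0 => he (sub_eq_zero.mp h0)), if_neg (fun h0 => he h0.2), mul_zero]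
    · simp only [if_neg hju, Finset.sum_const_zero]
      rw [if_neg (fun h0 => hju h0.1)]
  simp_rw [hj]
  rw [Finset.sum_comm, Finset.mul_sum]
  refine Finset.sum_congr rfl fun h _ => ?_
  -- the `j`-sum has the single term `j = a h`
  rw [Finset.sum_eq_single (a * ((h : ℕ) : ZMod q))]
  · have hu : IsUnit (a * ((h : ℕ) : ZMod q)) ↔ IsUnit ((h : ℕ) : ZMod q) :=
      ⟨fun hx => isUnit_of_mul_isUnit_right hx, fun hx => ha.mul hx⟩
    by_cases hh : IsUnit ((h : ℕ) : ZMod q)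
    · rw [if_pos hh, if_pos ⟨hu.mpr hh, by linear_combination ((h : ℕ) : ZMod q) * ia⟩]
    · rw [if_neg hh, if_neg (fun h0 => hh (hu.mp h0.1)), mul_zero]
  · intro j _ hne
    rw [if_neg]
    rintro ⟨_, he⟩
    apply hne
    linear_combination a * he + (-j) * ia
  · intro h0; exact absurd (Finset.mem_univ _) h0

/-! ### B2: `∑_{k ≤ q} (k², D)^{1/2}/k ≪ d(D) log q` -/

omit [NeZero q] in
/-- `(k², D) ≤ (k, D)²`. [folklore] -/
theorem gcd_sq_le_sq_gcd (k D : ℕ) (hD : D ≠ 0) : Nat.gcd (k ^ 2) D ≤ (Nat.gcd k D) ^ 2 := by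
  rcases Nat.eq_zero_or_pos k with rfl | hk
  · rw [zero_pow two_ne_zero, Nat.gcd_zero_left]
    exact Nat.le_self_pow two_ne_zero D
  have hg0 : 0 < Nat.gcd k D := Nat.gcd_pos_of_pos_left _ hk
  have hcop := Nat.coprime_div_gcd_div_gcd hg0
  obtain ⟨k', hk'⟩ := Nat.gcd_dvd_left k D
  obtain ⟨D', hD'⟩ := Nat.gcd_dvd_right k D
  generalize hg : Nat.gcd k D = g at hk' hD' hcop hg0
  subst hk'
  subst hD'
  rw [Nat.mul_div_cancel_left k' hg0, Nat.mul_div_cancel_left D' hg0] at hcop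
  rw [show (g * k') ^ 2 = g * (g * k' ^ 2) by ring, Nat.gcd_mul_left, show g ^ 2 = g * g from sq g]
  refine Nat.mul_le_mul_left g ?_
  rw [Nat.Coprime.gcd_mul_right_cancel g (Nat.Coprime.pow_left 2 hcop)]
  exact Nat.le_of_dvd hg0 (Nat.gcd_dvd_left _ _)

omit [NeZero q] in
/-- Hence `√(k², D) ≤ (k, D)`. [folklore] -/
theorem sqrt_gcd_sq_le (k D : ℕ) (hD : D ≠ 0) : Real.sqrt (Nat.gcd (k ^ 2) D : ℝ) ≤ (Nat.gcd k D : ℝ) := by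
  rw [Real.sqrt_le_left (Nat.cast_nonneg _)]
  exact_mod_cast gcd_sq_le_sq_gcd k D hD

omit [NeZero q] in
/-- The harmonic sum over multiples: `∑_{k ≤ N, d ∣ k} d/k ≤ 1 + log N` (`d ≥ 1`). [folklore] -/
theorem sum_div_filter_dvd_le (N d : ℕ) (hd : 0 < d) :
    ∑ k ∈ (Finset.Icc 1 N).filter (fun k => d ∣ k), (d : ℝ) / k ≤ 1 + Real.log N := by
  -- reindex `k = d m`, `m ≤ N / d`
  have hsub : ∑ k ∈ (Finset.Icc 1 N).filter (fun k => d ∣ k), (d : ℝ) / k ≤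
      ∑ m ∈ Finset.Icc 1 N, (1 : ℝ) / m := by
    rw [Finset.sum_filter]
    calc ∑ k ∈ Finset.Icc 1 N, (if d ∣ k then (d : ℝ) / k else 0)
        = ∑ k ∈ Finset.Icc 1 N, (if d ∣ k then (1 : ℝ) / (k / d : ℕ) else 0) := by
          refine Finset.sum_congr rfl fun k hk => ?_
          split_ifs with hdk
          · obtain ⟨m, rfl⟩ := hdk
            have hm : 0 < m := by
              rcases Nat.eq_zero_or_pos m with rfl | hm
              · simp at hk
              · exact hm
            rw [Nat.mul_div_cancel_left m hd]
            have hd0 : (d : ℝ) ≠ 0 := by exact_mod_cast hd.ne'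
            have hm0 : (m : ℝ) ≠ 0 := by exact_mod_cast hm.ne'
            push_cast
            field_simp
          · rfl
      _ ≤ ∑ m ∈ Finset.Icc 1 N, (1 : ℝ) / m := by
          -- the map `k ↦ k / d` is injective on multiples of `d` and lands in `Icc 1 N`
          rw [← Finset.sum_filter]
          rw [← Finset.sum_image (f := fun m : ℕ => (1 : ℝ) / m) (s := (Finset.Icc 1 N).filter (fun k => d ∣ k))
            (g := fun k => k / d) ?_]
          · refine Finset.sum_le_sum_of_subset_of_nonneg ?_ (fun _ _ _ => by positivity)
            intro m hm
            rw [Finset.mem_image] at hm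
            obtain ⟨k, hk, rfl⟩ := hm
            rw [Finset.mem_filter, Finset.mem_Icc] at hk
            obtain ⟨⟨hk1, hkN⟩, ⟨c, rfl⟩⟩ := hk
            rw [Finset.mem_Icc, Nat.mul_div_cancel_left c hd]
            constructor
            · rcases Nat.eq_zero_or_pos c with rfl | hc
              · simp at hk1
              · exact hc
            · exact le_trans (Nat.le_mul_of_pos_left c hd) hkN
          · intro k₁ hk₁ k₂ hk₂ he
            rw [Finset.mem_coe, Finset.mem_filter] at hk₁ hk₂
            obtain ⟨c₁, rfl⟩ := hk₁.2
            obtain ⟨c₂, rfl⟩ := hk₂.2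
            simp only [Nat.mul_div_cancel_left _ hd] at he
            rw [he]
  refine hsub.trans ?_
  -- harmonic bound
  rcases Nat.eq_zero_or_pos N with rfl | hN
  · simp
  · have h := harmonic_le_one_add_log N
    have e : ∑ m ∈ Finset.Icc 1 N, (1 : ℝ) / m = (harmonic N : ℝ) := by
      rw [harmonic_eq_sum_Icc]; push_cast
      refine Finset.sum_congr rfl fun m _ => by simp
    rw [e]
    exact h

omit [NeZero q] in
/-- `(k, D) ≤ ∑_{d ∣ D, d ∣ k} d` (the gcd is one of the terms). [folklore] -/
theorem gcd_le_sum_divisors_filter (k D : ℕ) (hD : D ≠ 0) :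
    (Nat.gcd k D : ℝ) ≤ ∑ d ∈ (Nat.divisors D).filter (fun d => d ∣ k), (d : ℝ) := by
  have hmem : Nat.gcd k D ∈ (Nat.divisors D).filter (fun d => d ∣ k) := by
    rw [Finset.mem_filter, Nat.mem_divisors]
    exact ⟨⟨Nat.gcd_dvd_right _ _, hD⟩, Nat.gcd_dvd_left _ _⟩
  have := Finset.single_le_sum (f := fun d : ℕ => (d : ℝ)) (fun _ _ => Nat.cast_nonneg _) hmem
  exact this

omit [NeZero q] in
/-- **HB p. 43**: `∑_{1 ≤ k ≤ N} (k², D)^{1/2}/k ≤ d(D) (1 + log N)`. [cite: HeathBrown1986d3, §4 p.43] -/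
theorem sum_sqrt_gcd_sq_div_le (N D : ℕ) (hD : D ≠ 0) :
    ∑ k ∈ Finset.Icc 1 N, Real.sqrt (Nat.gcd (k ^ 2) D : ℝ) / k ≤ (Nat.divisors D).card * (1 + Real.log N) := by
  calc ∑ k ∈ Finset.Icc 1 N, Real.sqrt (Nat.gcd (k ^ 2) D : ℝ) / k
      ≤ ∑ k ∈ Finset.Icc 1 N, (∑ d ∈ (Nat.divisors D).filter (fun d => d ∣ k), (d : ℝ)) / k := by
        refine Finset.sum_le_sum fun k _ => ?_
        exact div_le_div_of_nonneg_right ((sqrt_gcd_sq_le k D hD).trans (gcd_le_sum_divisors_filter k D hD))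
          (Nat.cast_nonneg k)
    _ = ∑ k ∈ Finset.Icc 1 N, ∑ d ∈ Nat.divisors D, (if d ∣ k then (d : ℝ) / k else 0) := by
        refine Finset.sum_congr rfl fun k _ => ?_
        rw [Finset.sum_filter, Finset.sum_div]
        refine Finset.sum_congr rfl fun d _ => ?_
        split_ifs <;> simp
    _ = ∑ d ∈ Nat.divisors D, ∑ k ∈ (Finset.Icc 1 N).filter (fun k => d ∣ k), (d : ℝ) / k := by
        rw [Finset.sum_comm]
        refine Finset.sum_congr rfl fun d _ => ?_
        rw [Finset.sum_filter]
    _ ≤ ∑ _d ∈ Nat.divisors D, (1 + Real.log N) := by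
        refine Finset.sum_le_sum fun d hd => ?_
        exact sum_div_filter_dvd_le N d (Nat.pos_of_mem_divisors hd)
    _ = (Nat.divisors D).card * (1 + Real.log N) := by rw [Finset.sum_const, nsmul_eq_mul]

/-! ### Unit scaling in the first two slots of `K₂`; `a`-independence of `N₁` -/

/-- `K₂(ρr', σs', c; q) = K₂(ρ, σ, r's'c; q)` for units `r', s'` (substitute `x ↦ r̄'x`, `y ↦ s̄'y`).
[cite: HeathBrown1986d3, §4 p.41] -/
theorem K2_scale_units {r' s' : ZMod q} (hr : IsUnit r') (hs : IsUnit s') (ρ σ c : ZMod q) :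
    K2 q (ρ * r') (σ * s') c = K2 q ρ σ (r' * s' * c) := by
  classical
  obtain ⟨u, rfl⟩ := hr
  obtain ⟨v, rfl⟩ := hs
  unfold K2
  -- `x = u⁻¹ x'`, `y = v⁻¹ y'`
  rw [← Equiv.sum_comp (Units.mulLeft (u⁻¹ : (ZMod q)ˣ))]
  refine Finset.sum_congr rfl fun x _ => ?_
  rw [← Equiv.sum_comp (Units.mulLeft (v⁻¹ : (ZMod q)ˣ))]
  refine Finset.sum_congr rfl fun y _ => ?_
  simp only [Units.mulLeft_apply]
  have hux : IsUnit ((u⁻¹ : (ZMod q)ˣ) * x : ZMod q) ↔ IsUnit x :=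
    ⟨fun h => by simpa using (Units.isUnit u).mul h, fun h => (Units.isUnit _).mul h⟩
  have huy : IsUnit ((v⁻¹ : (ZMod q)ˣ) * y : ZMod q) ↔ IsUnit y :=
    ⟨fun h => by simpa using (Units.isUnit v).mul h, fun h => (Units.isUnit _).mul h⟩
  by_cases hx : IsUnit x
  · by_cases hy : IsUnit y
    · rw [if_pos ⟨hux.mpr hx, huy.mpr hy⟩, if_pos ⟨hx, hy⟩]
      congr 1
      have ix : x * x⁻¹ = 1 := ZMod.mul_inv_of_unit x hx
      have iy : y * y⁻¹ = 1 := ZMod.mul_inv_of_unit y hy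
      have e1 : (((u⁻¹ : (ZMod q)ˣ) : ZMod q) * x)⁻¹ = (u : ZMod q) * x⁻¹ := by
        apply ZMod.inv_eq_of_mul_eq_one
        calc ((u⁻¹ : (ZMod q)ˣ) : ZMod q) * x * ((u : ZMod q) * x⁻¹)
            = (((u⁻¹ : (ZMod q)ˣ) : ZMod q) * (u : ZMod q)) * (x * x⁻¹) := by ring
          _ = 1 := by rw [Units.inv_mul, ix, one_mul]
      have e2 : (((v⁻¹ : (ZMod q)ˣ) : ZMod q) * y)⁻¹ = (v : ZMod q) * y⁻¹ := by
        apply ZMod.inv_eq_of_mul_eq_one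
        calc ((v⁻¹ : (ZMod q)ˣ) : ZMod q) * y * ((v : ZMod q) * y⁻¹)
            = (((v⁻¹ : (ZMod q)ˣ) : ZMod q) * (v : ZMod q)) * (y * y⁻¹) := by ring
          _ = 1 := by rw [Units.inv_mul, iy, one_mul]
      rw [e1, e2]
      have h1 : ρ * (u : ZMod q) * (((u⁻¹ : (ZMod q)ˣ) : ZMod q) * x) = ρ * x := by
        rw [← mul_assoc, mul_assoc ρ, Units.mul_inv, mul_one]
      have h2 : σ * (v : ZMod q) * (((v⁻¹ : (ZMod q)ˣ) : ZMod q) * y) = σ * y := by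
        rw [← mul_assoc, mul_assoc σ, Units.mul_inv, mul_one]
      rw [h1, h2]
      ring
    · rw [if_neg (fun h => hy (huy.mp h.2)), if_neg (fun h => hy h.2)]
  · rw [if_neg (fun h => hx (hux.mp h.1)), if_neg (fun h => hx h.1)]

/-- **`a`-independence of the `r ≡ 0` terms**: `K₂(0, σ, at; q) = K₂(0, σ, t; q)` for a unit `a`.
[cite: HeathBrown1986d3, §4 p.41] -/
theorem K2_first_zero_unit_mul {a : ZMod q} (ha : IsUnit a) (σ t : ZMod q) :
    K2 q 0 σ (a * t) = K2 q 0 σ t := by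
  have := K2_scale_units ha isUnit_one (0 : ZMod q) σ t
  rw [zero_mul, mul_one, mul_one] at this
  exact this.symm

/-- `K₂(ρ, 0, at; q) = K₂(ρ, 0, t; q)` for a unit `a`. [cite: HeathBrown1986d3, §4 p.41] -/
theorem K2_second_zero_unit_mul {a : ZMod q} (ha : IsUnit a) (ρ t : ZMod q) :
    K2 q ρ 0 (a * t) = K2 q ρ 0 t := by
  have := K2_scale_units isUnit_one ha ρ (0 : ZMod q) t
  rw [zero_mul, mul_one, one_mul] at this
  exact this.symm

/-! ### Counting: `∑_{m ≤ M} (m, q) ≤ d(q) M` -/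

omit [NeZero q] in
/-- **`∑_{1 ≤ m ≤ M} (m, q) ≤ d(q) · M`** (`q ≥ 1`). [folklore] -/
theorem sum_gcd_le_card_divisors_mul (hq : q ≠ 0) (M : ℕ) :
    ∑ m ∈ Finset.Icc 1 M, (Nat.gcd m q : ℝ) ≤ (Nat.divisors q).card * M := by
  calc ∑ m ∈ Finset.Icc 1 M, (Nat.gcd m q : ℝ)
      ≤ ∑ m ∈ Finset.Icc 1 M, ∑ e ∈ (Nat.divisors q).filter (fun e => e ∣ m), (e : ℝ) :=
        Finset.sum_le_sum fun m _ => gcd_le_sum_divisors_filter m q hq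
    _ = ∑ e ∈ Nat.divisors q, ∑ m ∈ (Finset.Icc 1 M).filter (fun m => e ∣ m), (e : ℝ) := by
        rw [Finset.sum_comm' (t' := Nat.divisors q) (s' := fun e => (Finset.Icc 1 M).filter (fun m => e ∣ m))]
        intro e m
        simp only [Finset.mem_filter]
        tauto
    _ ≤ ∑ _e ∈ Nat.divisors q, (M : ℝ) := by
        refine Finset.sum_le_sum fun e he => ?_
        have he0 : 0 < e := Nat.pos_of_mem_divisors he
        rw [Finset.sum_const, nsmul_eq_mul]
        -- `#{m ≤ M : e ∣ m} = M / e`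
        have hcard : ((Finset.Icc 1 M).filter (fun m => e ∣ m)).card ≤ M / e := by
          rw [show (Finset.Icc 1 M).filter (fun m => e ∣ m) = (Finset.Ioc 0 M).filter (fun m => e ∣ m) by
            rfl, Nat.Ioc_filter_dvd_card_eq_div]
        calc (((Finset.Icc 1 M).filter (fun m => e ∣ m)).card : ℝ) * e ≤ (M / e : ℕ) * e := by
              gcongr
          _ ≤ M := by exact_mod_cast Nat.div_mul_le_self M e
    _ = (Nat.divisors q).card * M := by rw [Finset.sum_const, nsmul_eq_mul]

/-! ### The `q`-part of an integer: `N = ρ r'` with `ρ ∣ q^∞` and `(r', q) = 1` -/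

omit [NeZero q] in
/-- The `q`-part `ρ(N) = ∏_{p ∣ q} p^{v_p(N)}` of `N`. [cite: HeathBrown1986d3, §4 p.41] -/
def qpart (q N : ℕ) : ℕ := ((N.factorization).filter (fun p => p ∈ q.primeFactors)).prod (· ^ ·)

omit [NeZero q] in
/-- Unfolding `qpart`. [cite: HeathBrown1986d3, §4 p.41] -/
theorem qpart_def (q N : ℕ) :
    qpart q N = ((N.factorization).filter (fun p => p ∈ q.primeFactors)).prod (· ^ ·) := rfl

omit [NeZero q] in
/-- The defining Finsupp is dominated by the factorization of `N`. [folklore] -/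
theorem filter_factorization_le (q N : ℕ) :
    (N.factorization).filter (fun p => p ∈ q.primeFactors) ≤ N.factorization := by
  intro p
  rw [Finsupp.filter_apply]
  split_ifs <;> simp

omit [NeZero q] in
/-- `ρ(N) ∣ N`. [folklore] -/
theorem qpart_dvd (q N : ℕ) : qpart q N ∣ N :=
  Nat.prod_pow_dvd_of_le_factorization (filter_factorization_le q N)

omit [NeZero q] in
/-- `ρ(N) ≠ 0`. [folklore] -/
theorem qpart_ne_zero (q : ℕ) {N : ℕ} (hN : N ≠ 0) : qpart q N ≠ 0 := fun h =>
  hN (Nat.eq_zero_of_zero_dvd (h ▸ qpart_dvd q N))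

omit [NeZero q] in
/-- The factorization of `ρ(N)`. [folklore] -/
theorem factorization_qpart (q N : ℕ) :
    (qpart q N).factorization = (N.factorization).filter (fun p => p ∈ q.primeFactors) :=
  Nat.factorization_prod_pow_eq_self_of_le_factorization (filter_factorization_le q N)

omit [NeZero q] in
/-- The prime factors of `ρ(N)` divide `q`. [folklore] -/
theorem primeFactors_qpart_subset (q N : ℕ) : (qpart q N).primeFactors ⊆ q.primeFactors := by
  intro p hp
  rw [← Nat.support_factorization, factorization_qpart, Finsupp.mem_support_iff, Finsupp.filter_apply] at hp
  by_contra h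
  rw [if_neg h] at hp
  exact hp rfl

omit [NeZero q] in
/-- **`(N/ρ(N), q) = 1`** (`N, q ≠ 0`). [cite: HeathBrown1986d3, §4 p.41] -/
theorem coprime_div_qpart {q N : ℕ} (hq : q ≠ 0) (hN : N ≠ 0) : Nat.Coprime (N / qpart q N) q := by
  refine Nat.coprime_of_dvd fun p hp hpN hpq => ?_
  have hdiv : (N / qpart q N) ≠ 0 := by
    intro h0
    rcases Nat.div_eq_zero_iff.mp h0 with h1 | h1
    · exact qpart_ne_zero q hN h1
    · exact absurd (Nat.le_of_dvd (Nat.pos_of_ne_zero hN) (qpart_dvd q N)) (not_le.mpr h1)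
  have hpos := Nat.Prime.factorization_pos_of_dvd hp hdiv hpN
  rw [Nat.factorization_div (qpart_dvd q N), Finsupp.tsub_apply, factorization_qpart, Finsupp.filter_apply,
    if_pos (Nat.mem_primeFactors.mpr ⟨hp, hpq, hq⟩), Nat.sub_self] at hpos
  exact lt_irrefl 0 hpos

omit [NeZero q] in
/-- `(ρ(N), q) = (N, q)`. [folklore] -/
theorem gcd_qpart_eq {q N : ℕ} (hq : q ≠ 0) (hN : N ≠ 0) : Nat.gcd (qpart q N) q = Nat.gcd N q := by
  have hcop : Nat.Coprime (N / qpart q N) q := coprime_div_qpart hq hN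
  calc Nat.gcd (qpart q N) q = Nat.gcd (qpart q N * (N / qpart q N)) q :=
        (Nat.Coprime.gcd_mul_right_cancel (qpart q N) hcop).symm
    _ = Nat.gcd N q := by rw [Nat.mul_div_cancel' (qpart_dvd q N)]

/-! ### `∑_{n ≤ B, rad(n) ∣ q} n^{-t} ≤ ∏_{p ∣ q} (1 − p^{−t})⁻¹` (replaces HB's use of de Bruijn) -/

omit [NeZero q] in
/-- **Sum of `n^{-t}` over `S`-smooth `n ≤ B`** is at most `∏_{p ∈ S} (1 − p^{−t})⁻¹` (`t > 0`, `S` a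
finite set of primes). [folklore] -/
theorem sum_smooth_rpow_neg_le (S : Finset ℕ) (hS : ∀ p ∈ S, p.Prime) {t : ℝ} (ht : 0 < t) (B : ℕ) :
    ∑ n ∈ (Finset.Icc 1 B).filter (fun n => n.primeFactors ⊆ S), (n : ℝ) ^ (-t) ≤
      ∏ p ∈ S, (1 - (p : ℝ) ^ (-t))⁻¹ := by
  induction S using Finset.induction_on generalizing B with
  | empty =>
      rw [Finset.prod_empty]
      have hsub : (Finset.Icc 1 B).filter (fun n => n.primeFactors ⊆ (∅ : Finset ℕ)) ⊆ {1} := by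
        intro n hn
        rw [Finset.mem_filter, Finset.mem_Icc, Finset.subset_empty, Nat.primeFactors_eq_empty] at hn
        rw [Finset.mem_singleton]
        rcases hn.2 with h | h
        · omega
        · exact h
      calc ∑ n ∈ (Finset.Icc 1 B).filter (fun n => n.primeFactors ⊆ (∅ : Finset ℕ)), (n : ℝ) ^ (-t)
          ≤ ∑ n ∈ ({1} : Finset ℕ), (n : ℝ) ^ (-t) :=
            Finset.sum_le_sum_of_subset_of_nonneg hsub (fun _ _ _ => by positivity)
        _ = 1 := by simp
  | insert p S hpS ih =>
      have hp : p.Prime := hS p (Finset.mem_insert_self p S)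
      have hS' : ∀ r ∈ S, r.Prime := fun r hr => hS r (Finset.mem_insert_of_mem hr)
      have hp0 : (0 : ℝ) < p := by exact_mod_cast hp.pos
      have hx0 : 0 < (p : ℝ) ^ (-t) := Real.rpow_pos_of_pos hp0 _
      have hx1 : (p : ℝ) ^ (-t) < 1 := by
        have h2 : (1 : ℝ) < p := by exact_mod_cast hp.one_lt
        exact Real.rpow_lt_one_of_one_lt_of_neg h2 (by linarith)
      set A' := (Finset.Icc 1 B).filter (fun n => n.primeFactors ⊆ insert p S) with hA'
      set AS := (Finset.Icc 1 B).filter (fun n => n.primeFactors ⊆ S) with hAS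
      set g : ℕ → ℕ × ℕ := fun n => (n.factorization p, ordCompl[p] n) with hg
      set F : ℕ × ℕ → ℝ := fun y => ((p : ℝ) ^ (-t)) ^ y.1 * (y.2 : ℝ) ^ (-t) with hF
      have hF0 : ∀ y, 0 ≤ F y := fun y => by simp only [hF]; positivity
      -- `n^{-t} = F (g n)`
      have hval : ∀ n ∈ A', (n : ℝ) ^ (-t) = F (g n) := by
        intro n hn
        rw [Finset.mem_filter, Finset.mem_Icc] at hn
        have hn0 : n ≠ 0 := by omega
        simp only [hF, hg]
        conv_lhs => rw [← Nat.ordProj_mul_ordCompl_eq_self n p]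
        rw [Nat.cast_mul, Real.mul_rpow (by positivity) (by positivity)]
        congr 1
        rw [Nat.cast_pow, ← Real.rpow_natCast (p : ℝ) (n.factorization p), ← Real.rpow_mul hp0.le, mul_comm,
          Real.rpow_mul hp0.le, Real.rpow_natCast]
      -- `g` is injective on `A'` and lands in `range (B+1) × AS`
      have hinj : Set.InjOn g A' := by
        intro n₁ _ n₂ _ h
        simp only [hg, Prod.mk.injEq] at h
        have e1 := Nat.ordProj_mul_ordCompl_eq_self n₁ p
        have e2 := Nat.ordProj_mul_ordCompl_eq_self n₂ p
        rw [← e1, ← e2, h.2, h.1]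
      have himg : A'.image g ⊆ Finset.range (B + 1) ×ˢ AS := by
        intro y hy
        rw [Finset.mem_image] at hy
        obtain ⟨n, hn, rfl⟩ := hy
        rw [Finset.mem_filter, Finset.mem_Icc] at hn
        have hn0 : n ≠ 0 := by omega
        simp only [hg, Finset.mem_product, Finset.mem_range, hAS, Finset.mem_filter, Finset.mem_Icc]
        refine ⟨?_, ⟨?_, ?_⟩, ?_⟩
        · exact Nat.lt_succ_of_le ((Nat.factorization_lt p hn0).le.trans hn.1.2)
        · exact Nat.ordCompl_pos p hn0
        · exact (Nat.ordCompl_le n p).trans hn.1.2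
        · intro r hr
          rw [← Nat.support_factorization, Nat.factorization_ordCompl, Finsupp.support_erase,
            Nat.support_factorization, Finset.mem_erase] at hr
          have := hn.2 hr.2
          rw [Finset.mem_insert] at this
          rcases this with h | h
          · exact absurd h hr.1
          · exact h
      calc ∑ n ∈ A', (n : ℝ) ^ (-t) = ∑ n ∈ A', F (g n) := Finset.sum_congr rfl hval
        _ = ∑ y ∈ A'.image g, F y := (Finset.sum_image hinj).symm
        _ ≤ ∑ y ∈ Finset.range (B + 1) ×ˢ AS, F y :=
            Finset.sum_le_sum_of_subset_of_nonneg himg (fun y _ _ => hF0 y)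
        _ = (∑ e ∈ Finset.range (B + 1), ((p : ℝ) ^ (-t)) ^ e) * ∑ m ∈ AS, (m : ℝ) ^ (-t) := by
            rw [Finset.sum_product, Finset.sum_mul]
            refine Finset.sum_congr rfl fun e _ => ?_
            rw [Finset.mul_sum]
        _ ≤ (1 - (p : ℝ) ^ (-t))⁻¹ * ∏ r ∈ S, (1 - (r : ℝ) ^ (-t))⁻¹ := by
            have hgeom : ∑ e ∈ Finset.range (B + 1), ((p : ℝ) ^ (-t)) ^ e ≤ (1 - (p : ℝ) ^ (-t))⁻¹ := by
              rw [geom_sum_eq hx1.ne, show ((p : ℝ) ^ (-t)) ^ (B + 1) - 1 = -(1 - ((p : ℝ) ^ (-t)) ^ (B + 1)) by ring,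
                show (p : ℝ) ^ (-t) - 1 = -(1 - (p : ℝ) ^ (-t)) by ring, neg_div_neg_eq,
                div_le_iff₀ (by linarith), inv_mul_cancel₀ (by linarith)]
              have : 0 ≤ ((p : ℝ) ^ (-t)) ^ (B + 1) := by positivity
              linarith
            refine mul_le_mul hgeom (ih hS' B)
              (Finset.sum_nonneg fun _ _ => by positivity) (inv_nonneg.mpr (by linarith))
        _ = ∏ r ∈ insert p S, (1 - (r : ℝ) ^ (-t))⁻¹ := by rw [Finset.prod_insert hpS]

end Literature.NumberTheory.Sieve.HeathBrown1986
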